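import Summits.QuantumFields.BalabanUV.T4Continuum.Spine.NE1p.DressedCellNecessity

/-!
# T⁴ programme, spine estimate NE1′ (node O3b/H2) — THE BUDGET-COUPLED BLOCKING THRESHOLD: what (w7) AND (w6) force TOGETHER, in
# kernel (located cost LF-4 «integer blocking factor at the terminal faces» made exact; companion of `Spine/NE1p/DressedCellNecessity.lean`)

Cell `pub-balaban`, sub-cell `t4`, BINDER-OWNERS row NE1′, formalisation crew `b2b-balaban-t4-ne1p-formalise-*`, seat `…-leaf-07`
(gen 5; own-initiative LOCATED-COST item «S3c.1» in the lineage of row S3c `DressedCellNecessity` p213339, journal `CLAIMS.log`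
LOCATED NOTE l.11470, INTENT NE1p-S3c.1 l.11517; BOOKED by the typer, RULING R-T59 (iii)∕(iv), node N23d1).  ADDITIVE — imports `Spine/NE1p/DressedCellNecessity` (S3c; through it rows S3 `DressedUniformConstants` p212599 and
S3-sup `DressedUniformConstantsOf` p213131) ONLY, modifies nothing; THEOREMS ONLY (no `def`, no `def … : Prop`, 0 citations).

WHY THIS FILE.  Row S3c located what the (w7) binder pair `hloc : locCell L C c̄ κ ≤ ρ′`, `hρ′1 : ρ′ < 1` of END-B's one K-free
`U := uniformConstantsCell …` forces ON ITS OWN (`e³(1+4κ) < L`; integer thresholds 21 ∕ 41 ∕ 181 at `κ = 0 ∕ ¼ ∕ 2`), and what the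
(w6) binder `hsmall : m·(N₀A₀(1−ρ′)⁻¹) ≤ 1 − s̄⁰` forces ON ITS OWN (`s̄⁰ ≤ 1`; `s̄⁰ < 1` under a live source; the source cap).  The
two binders share `ρ′`, so TOGETHER they force more: eliminating `ρ′`,

  `alphaCell κ · (1 − s̄⁰) + L · (m·N₀·A₀) ≤ L · (1 − s̄⁰)`            (`coupled_of_cell_window`, §1),

i.e. the block size must exceed the step factor by the factor `(1 − s̄⁰)∕(1 − s̄⁰ − mN₀A₀)`: the action margin `s̄⁰` (THE NUMBER
of (w2-act)) and the source strength `m·N₀·A₀` of the dressed budget are paid for in BLOCK SIZE.  This is the arithmetic behind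
the crew's located finding LF-4 (typer R-T56 (h), `DAG.md` §3b: «at κ = ½ any firing needs an integer L ≥ 121; at κ → 0, L ≥ 21»):
§2 makes its numerals kernel consequences of the cell's SHAPES — at `κ = ½` with a quarter-strength source (`¼ ≤ m·N₀·A₀`, the
value of the crew's function-level toys W7 ∕ W9, `m = ‖c₀‖ = ¼`, `N₀ = A₀ = 1`) the threshold is `4e³ ≤ L`, i.e. **`81 ≤ L`**
when no action margin is charged (`0 ≤ s̄⁰`), and `6e³ ≤ L`, i.e. **`121 ≤ L`**, when THE NUMBER is charged at `½ ≤ s̄⁰` (row W9);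
with no source at all it is S3c's bare `3e³ < L`, i.e. **`61 ≤ L`**.  §3 shows each integer threshold is SHARP by inhabiting
`L = 81 ∕ 121 ∕ 61` (the first two with EQUALITY in (w6)).  So «121» is the price of `s̄⁰ = ½` under a `¼`-source, not of `κ = ½`.
§4 reads §1 on END-B's one `U := uniformConstantsCell …`.  §5 is the OTHER half of LF-4, the (I4′) rate binder `hrate` of the
terminal faces (`defect ≤ c_δ·ψ^(k−k′)`, `ψ = L⁻²`, at every scale of every cutoff): a geometric defect family `c·φ^k` with `c > 0`
meets it only if `φ ≤ ψ` (`rate_le_of_pow_dominated`), i.e. a toy with internal block size `Lt` caps the cell's by `L ≤ Lt`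
(`blockSize_le_of_pow_dominated`; for the crew's `towerM`, `Lt = LW = 6e³`, so a terminal face fires on it only at integer
`81 ≤ L ≤ 120`).

HONEST FRAMING.  Every statement is a CONSEQUENCE of the cell's bookkeeping shapes (`locCell`, the (w6) field of
`UniformConstants` — the hypotheses are typed as the LITERAL (w6)∕(w7) shapes: `hsmall : m * (N₀ * A₀ * (1 - ρ')⁻¹) ≤ 1 - sbar` as in
S3l's telescope, `hloc : locCell L C c̄ κ ≤ ρ′`, `hρ′1 : ρ′ < 1` as in S3's `uniformConstantsCell`), decided in kernel ([arith] ∕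
[decided numeral]; no new numeric engine: `Real.exp_one_gt_d9`∕`lt_d9` via S3c's `exp_three_gt_20_08` ∕ `exp_three_lt_20_09` BY
NAME).  k2: these are thresholds of the CELL's shapes on the toys' constants — never «Bałaban's L» («a fixed large integer», no printed
numeral), never his action margin or his densities.  0 sorry; no `def`, no `def … : Prop`; 0 citations.  Headline (c4): «located cost
only; NE1′ ⇐ the named binders, NOT proved»; NE1′ is NOT printed; spine PROVED 0∕9.  Rung (B)+1 on ONE finite four-torus — NOT infinite
volume, NOT a mass gap, NOT OS on ℝ⁴, NOT Clay.  HONEST DEPENDENCY: continuum YM on T⁴ ⇐ BetaPertH ∧ nine spine estimates (0/9 proved);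
BetaPertH ⇐ (D1) ∧ (D4) ∧ CAP+tail; G-an2-4 gates asym, D1 and NE2/3/4.
-/

noncomputable section

namespace Summit.QuantumFields.BalabanUV.T4Continuum.NE1p.DressedCellNecessityBudget

open Literature.MathematicalPhysics.QuantumFieldTheory.Balaban1983to89
open Summit.QuantumFields.BalabanUV.T4Continuum.NE1p.DressedRoot
open Summit.QuantumFields.BalabanUV.T4Continuum.NE1p.DressedUniformConstants
open Summit.QuantumFields.BalabanUV.T4Continuum.NE1p.DressedCellNecessity

/-! ## §1 The coupled threshold: (w7) and (w6) with `ρ′` eliminated -/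

/-- (w6) alone caps the source by the strict-product slack: `m·N₀·A₀ ≤ (1 − s̄⁰)·(1 − ρ′)`. [arith] -/
theorem source_le_of_window {m N₀ A₀ sbar ρ' : ℝ} (hρ'1 : ρ' < 1) (hsmall : m * (N₀ * A₀ * (1 - ρ')⁻¹) ≤ 1 - sbar) :
    m * N₀ * A₀ ≤ (1 - sbar) * (1 - ρ') := by
  have h1 : 0 < 1 - ρ' := by linarith
  have hre : m * (N₀ * A₀ * (1 - ρ')⁻¹) = m * N₀ * A₀ / (1 - ρ') := by rw [div_eq_mul_inv]; ring
  rw [hre, div_le_iff₀ h1] at hsmall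
  linarith

/-- (w6) alone bounds the margin: `s̄⁰ ≤ 1` (the source term is nonnegative). [arith] -/
theorem sbar_le_one_of_window {m N₀ A₀ sbar ρ' : ℝ} (hm : 0 ≤ m) (hN₀ : 0 ≤ N₀) (hA₀ : 0 ≤ A₀) (hρ'1 : ρ' < 1)
    (hsmall : m * (N₀ * A₀ * (1 - ρ')⁻¹) ≤ 1 - sbar) : sbar ≤ 1 := by
  have h1 : 0 < 1 - ρ' := by linarith
  have : 0 ≤ m * (N₀ * A₀ * (1 - ρ')⁻¹) := by positivity
  linarith

/-- (w7) alone bounds the slack by the transport share: `L·(1 − ρ′) ≤ L − alphaCell κ` (`0 < L`, `C, c̄ ≥ 0`). [arith] -/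
theorem slack_le_of_loc {L C cbar κ ρ' : ℝ} (hL : 0 < L) (hC : 0 ≤ C) (hcbar : 0 ≤ cbar)
    (hloc : locCell L C cbar κ ≤ ρ') : L * (1 - ρ') ≤ L - alphaCell κ := by
  unfold locCell at hloc
  have hreg : 0 ≤ L * C * cbar := by positivity
  have h1 : alphaCell κ / L ≤ ρ' := by linarith
  rw [div_le_iff₀ hL] at h1
  nlinarith

/-- **THE BUDGET-COUPLED BLOCKING THRESHOLD** [arith]: the (w7) pair `hloc`∕`hρ′1` and the (w6) binder `hsmall` of
`uniformConstantsCell` (with `0 < L` and the signs) force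
`alphaCell κ·(1 − s̄⁰) + L·(m·N₀·A₀) ≤ L·(1 − s̄⁰)` — the step factor weighted by the margin's complement plus the block size
weighted by the source strength fit in the block size weighted by the margin's complement. -/
theorem coupled_of_cell_window {L C cbar κ m N₀ A₀ sbar ρ' : ℝ} (hL : 0 < L) (hC : 0 ≤ C) (hcbar : 0 ≤ cbar)
    (hm : 0 ≤ m) (hN₀ : 0 ≤ N₀) (hA₀ : 0 ≤ A₀) (hloc : locCell L C cbar κ ≤ ρ') (hρ'1 : ρ' < 1)
    (hsmall : m * (N₀ * A₀ * (1 - ρ')⁻¹) ≤ 1 - sbar) :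
    alphaCell κ * (1 - sbar) + L * (m * N₀ * A₀) ≤ L * (1 - sbar) := by
  have hsrc := source_le_of_window hρ'1 hsmall
  have hs1 : 0 ≤ 1 - sbar := by linarith [sbar_le_one_of_window hm hN₀ hA₀ hρ'1 hsmall]
  have hsl := slack_le_of_loc (κ := κ) hL hC hcbar hloc
  have h2 : L * (m * N₀ * A₀) ≤ (1 - sbar) * (L * (1 - ρ')) := by nlinarith
  have h3 : (1 - sbar) * (L * (1 - ρ')) ≤ (1 - sbar) * (L - alphaCell κ) := mul_le_mul_of_nonneg_left hsl hs1
  nlinarith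

/-- The same in quotient form: the source strength is capped by the margin's complement times the block-size slack,
`m·N₀·A₀ ≤ (1 − s̄⁰)·(1 − alphaCell κ∕L)`. [arith] -/
theorem source_le_of_cell_window {L C cbar κ m N₀ A₀ sbar ρ' : ℝ} (hL : 0 < L) (hC : 0 ≤ C) (hcbar : 0 ≤ cbar)
    (hm : 0 ≤ m) (hN₀ : 0 ≤ N₀) (hA₀ : 0 ≤ A₀) (hloc : locCell L C cbar κ ≤ ρ') (hρ'1 : ρ' < 1)
    (hsmall : m * (N₀ * A₀ * (1 - ρ')⁻¹) ≤ 1 - sbar) :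
    m * N₀ * A₀ ≤ (1 - sbar) * (1 - alphaCell κ / L) := by
  have h := coupled_of_cell_window hL hC hcbar hm hN₀ hA₀ hloc hρ'1 hsmall
  have hre : (1 - sbar) * (1 - alphaCell κ / L) = (L * (1 - sbar) - alphaCell κ * (1 - sbar)) / L := by
    field_simp
  rw [hre, le_div_iff₀ hL]
  have hc : m * N₀ * A₀ * L = L * (m * N₀ * A₀) := by ring
  linarith

/-- **THE THRESHOLD WITH A SOURCE FLOOR AND A MARGIN FLOOR** [arith]: if the source has strength at least `q` (`q ≤ m·N₀·A₀`) and
the margin is at least `s` (`s ≤ s̄⁰`) with `s + q < 1`, then `alphaCell κ·(1 − s) ≤ L·(1 − s − q)`: the block size is at least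
`alphaCell κ·(1 − s)∕(1 − s − q)`. -/
theorem threshold_of_floors {L C cbar κ m N₀ A₀ sbar ρ' q s : ℝ} (hL : 0 < L) (hC : 0 ≤ C) (hcbar : 0 ≤ cbar) (hκ : 0 ≤ κ)
    (hm : 0 ≤ m) (hN₀ : 0 ≤ N₀) (hA₀ : 0 ≤ A₀) (hloc : locCell L C cbar κ ≤ ρ') (hρ'1 : ρ' < 1)
    (hsmall : m * (N₀ * A₀ * (1 - ρ')⁻¹) ≤ 1 - sbar) (hq : q ≤ m * N₀ * A₀) (hs : s ≤ sbar) :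
    alphaCell κ * (1 - s) ≤ L * (1 - s - q) := by
  have h := coupled_of_cell_window hL hC hcbar hm hN₀ hA₀ hloc hρ'1 hsmall
  have hαL : alphaCell κ < L := (necessity_of_cell hL hC hcbar hκ hloc hρ'1).1
  -- raising the margin from `s` to `s̄⁰` costs `(L − alphaCell κ)·(s̄⁰ − s) ≥ 0`; lowering the source to `q` costs `L·(mN₀A₀ − q) ≥ 0`
  nlinarith

/-! ## §2 The located integer thresholds at `κ = ½` (the crew's toys W7 ∕ W9: `m = ‖c₀‖ = ¼`, `N₀ = A₀ = 1`) -/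

/-- `alphaCell ½ = 3e³`. [arith] -/
theorem alphaCell_half : alphaCell (1 / 2) = 3 * Real.exp 3 := by
  unfold alphaCell; ring

/-- **QUARTER SOURCE, NO MARGIN CHARGED ⟹ `4e³ ≤ L`** [arith]: at `κ = ½` with `¼ ≤ m·N₀·A₀` and `0 ≤ s̄⁰`. -/
theorem four_exp_three_le_of_quarterSource {L C cbar m N₀ A₀ sbar ρ' : ℝ} (hL : 0 < L) (hC : 0 ≤ C) (hcbar : 0 ≤ cbar)
    (hm : 0 ≤ m) (hN₀ : 0 ≤ N₀) (hA₀ : 0 ≤ A₀) (hloc : locCell L C cbar (1 / 2) ≤ ρ') (hρ'1 : ρ' < 1)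
    (hsmall : m * (N₀ * A₀ * (1 - ρ')⁻¹) ≤ 1 - sbar) (hq : 1 / 4 ≤ m * N₀ * A₀) (hs : 0 ≤ sbar) :
    4 * Real.exp 3 ≤ L := by
  have h := threshold_of_floors hL hC hcbar (by norm_num) hm hN₀ hA₀ hloc hρ'1 hsmall hq hs
  rw [alphaCell_half] at h
  linarith

/-- **… hence the INTEGER threshold `81 ≤ L`** [decided numeral] (`4e³ = 80.342…`; `4·20.08 = 80.32 < L`). -/
theorem eightyOne_le_of_quarterSource {L : ℕ} {C cbar m N₀ A₀ sbar ρ' : ℝ} (hL : 0 < L) (hC : 0 ≤ C) (hcbar : 0 ≤ cbar)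
    (hm : 0 ≤ m) (hN₀ : 0 ≤ N₀) (hA₀ : 0 ≤ A₀) (hloc : locCell (L : ℝ) C cbar (1 / 2) ≤ ρ') (hρ'1 : ρ' < 1)
    (hsmall : m * (N₀ * A₀ * (1 - ρ')⁻¹) ≤ 1 - sbar) (hq : 1 / 4 ≤ m * N₀ * A₀) (hs : 0 ≤ sbar) : 81 ≤ L := by
  have h := four_exp_three_le_of_quarterSource (Nat.cast_pos.mpr hL) hC hcbar hm hN₀ hA₀ hloc hρ'1 hsmall hq hs
  have h80 : (80 : ℝ) < (L : ℝ) := by have := exp_three_gt_20_08; linarith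
  have : (80 : ℕ) < L := by exact_mod_cast h80
  omega

/-- **QUARTER SOURCE, THE NUMBER CHARGED AT `½ ≤ s̄⁰` ⟹ `6e³ ≤ L`** [arith] (row W9 charges `s ≡ ½` in full). -/
theorem six_exp_three_le_of_quarterSource_half {L C cbar m N₀ A₀ sbar ρ' : ℝ} (hL : 0 < L) (hC : 0 ≤ C) (hcbar : 0 ≤ cbar)
    (hm : 0 ≤ m) (hN₀ : 0 ≤ N₀) (hA₀ : 0 ≤ A₀) (hloc : locCell L C cbar (1 / 2) ≤ ρ') (hρ'1 : ρ' < 1)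
    (hsmall : m * (N₀ * A₀ * (1 - ρ')⁻¹) ≤ 1 - sbar) (hq : 1 / 4 ≤ m * N₀ * A₀) (hs : 1 / 2 ≤ sbar) :
    6 * Real.exp 3 ≤ L := by
  have h := threshold_of_floors hL hC hcbar (by norm_num) hm hN₀ hA₀ hloc hρ'1 hsmall hq hs
  rw [alphaCell_half] at h
  linarith

/-- **… hence the INTEGER threshold `121 ≤ L`** [decided numeral] (`6e³ = 120.513…`; `6·20.08 = 120.48 < L`) — LF-4's «121» is
the price of `s̄⁰ = ½` under a quarter source, not of `κ = ½`. -/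
theorem oneTwentyOne_le_of_quarterSource_half {L : ℕ} {C cbar m N₀ A₀ sbar ρ' : ℝ} (hL : 0 < L) (hC : 0 ≤ C)
    (hcbar : 0 ≤ cbar) (hm : 0 ≤ m) (hN₀ : 0 ≤ N₀) (hA₀ : 0 ≤ A₀) (hloc : locCell (L : ℝ) C cbar (1 / 2) ≤ ρ') (hρ'1 : ρ' < 1)
    (hsmall : m * (N₀ * A₀ * (1 - ρ')⁻¹) ≤ 1 - sbar) (hq : 1 / 4 ≤ m * N₀ * A₀) (hs : 1 / 2 ≤ sbar) : 121 ≤ L := by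
  have h := six_exp_three_le_of_quarterSource_half (Nat.cast_pos.mpr hL) hC hcbar hm hN₀ hA₀ hloc hρ'1 hsmall hq hs
  have h120 : (120 : ℝ) < (L : ℝ) := by have := exp_three_gt_20_08; linarith
  have : (120 : ℕ) < L := by exact_mod_cast h120
  omega

/-- **NO SOURCE ⟹ S3c's bare largeness `3e³ < L`, INTEGER threshold `61 ≤ L`** at `κ = ½` [decided numeral] (`3e³ = 60.256…`). -/
theorem sixtyOne_le_of_cell_half {L : ℕ} {C cbar ρ' : ℝ} (hL : 0 < L) (hC : 0 ≤ C) (hcbar : 0 ≤ cbar)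
    (hloc : locCell (L : ℝ) C cbar (1 / 2) ≤ ρ') (hρ'1 : ρ' < 1) : 61 ≤ L := by
  have h := exp_three_mul_lt_of_cell (Nat.cast_pos.mpr hL) hC hcbar (by norm_num : (0:ℝ) ≤ 1 / 2) hloc hρ'1
  have h60 : (60 : ℝ) < (L : ℝ) := by have := exp_three_gt_20_08; linarith
  have : (60 : ℕ) < L := by exact_mod_cast h60
  omega

/-! ## §3 Sharpness: `L = 81 ∕ 121 ∕ 61` are inhabited (the first two with EQUALITY in (w6)) -/

/-- `locCell L C 0 ½ = 3e³∕L` (no regeneration term). [arith] -/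
theorem locCell_half_zero (L C : ℝ) : locCell L C 0 (1 / 2) = 3 * Real.exp 3 / L := by
  unfold locCell; rw [alphaCell_half]; ring

/-- **`L = 81` IS INHABITED with a quarter source and no margin** [decided numeral]: `locCell 81 C 0 ½ = 3e³∕81 ≤ ¾ = ρ′`
(`e³ ≤ 20.25`) and (w6) `¼·(1·1·(1 − ¾)⁻¹) = 1 ≤ 1 − 0` WITH EQUALITY. -/
theorem cell_window_eightyOne (C : ℝ) :
    locCell 81 C 0 (1 / 2) ≤ 3 / 4 ∧ (3 / 4 : ℝ) < 1 ∧ (1 / 4 : ℝ) * (1 * 1 * (1 - 3 / 4)⁻¹) ≤ 1 - 0 := by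
  refine ⟨?_, by norm_num, by norm_num⟩
  rw [locCell_half_zero, div_le_iff₀ (by norm_num : (0:ℝ) < 81)]
  have := exp_three_lt_20_09
  linarith

/-- **`L = 121` IS INHABITED with a quarter source and THE NUMBER `s̄⁰ = ½`** [decided numeral]: `3e³∕121 ≤ ½ = ρ′`
(`e³ ≤ 20.1666…`; `e³ < 20.09`) and (w6) `¼·(1·1·(1 − ½)⁻¹) = ½ ≤ 1 − ½` WITH EQUALITY. -/
theorem cell_window_oneTwentyOne (C : ℝ) :
    locCell 121 C 0 (1 / 2) ≤ 1 / 2 ∧ (1 / 2 : ℝ) < 1 ∧ (1 / 4 : ℝ) * (1 * 1 * (1 - 1 / 2)⁻¹) ≤ 1 - 1 / 2 := by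
  refine ⟨?_, by norm_num, by norm_num⟩
  rw [locCell_half_zero, div_le_iff₀ (by norm_num : (0:ℝ) < 121)]
  have := exp_three_lt_20_09
  linarith

/-- **`L = 61` IS INHABITED with no source** [decided numeral]: `3e³∕61 ≤ 99∕100 = ρ′` (`e³ ≤ 20.13`). -/
theorem locCell_sixtyOne_half_le (C : ℝ) : locCell 61 C 0 (1 / 2) ≤ 99 / 100 := by
  rw [locCell_half_zero, div_le_iff₀ (by norm_num : (0:ℝ) < 61)]
  have := exp_three_lt_20_09
  linarith

/-- **THE QUARTER-SOURCE THRESHOLD IS EXACTLY 81** [decided numeral]: for an integer block size `L ≥ 1`, the binder family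
{(w7) at `κ = ½`, (w6)} of `uniformConstantsCell` is inhabited by SOME nonnegative `C, c̄`, SOME source∕count∕amplitude with
`¼ ≤ m·N₀·A₀`, SOME margin `0 ≤ s̄⁰` and SOME `ρ′` iff `81 ≤ L`. -/
theorem quarterSource_inhabited_iff {L : ℕ} (hL : 0 < L) :
    (∃ C cbar m N₀ A₀ sbar ρ' : ℝ, 0 ≤ C ∧ 0 ≤ cbar ∧ 0 ≤ m ∧ 0 ≤ N₀ ∧ 0 ≤ A₀ ∧ 1 / 4 ≤ m * N₀ * A₀ ∧ 0 ≤ sbar ∧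
      locCell (L : ℝ) C cbar (1 / 2) ≤ ρ' ∧ ρ' < 1 ∧ m * (N₀ * A₀ * (1 - ρ')⁻¹) ≤ 1 - sbar) ↔ 81 ≤ L := by
  constructor
  · rintro ⟨C, cbar, m, N₀, A₀, sbar, ρ', hC, hcbar, hm, hN₀, hA₀, hq, hs, hloc, hρ'1, hsmall⟩
    exact eightyOne_le_of_quarterSource hL hC hcbar hm hN₀ hA₀ hloc hρ'1 hsmall hq hs
  · intro h81
    have hcast : (81 : ℝ) ≤ (L : ℝ) := by exact_mod_cast h81
    obtain ⟨h1, h2, h3⟩ := cell_window_eightyOne (0 : ℝ)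
    refine ⟨0, 0, 1 / 4, 1, 1, 0, 3 / 4, le_rfl, le_rfl, by norm_num, zero_le_one, zero_le_one, by norm_num, le_rfl, ?_, h2, h3⟩
    calc locCell (L : ℝ) 0 0 (1 / 2) = 3 * Real.exp 3 / L := locCell_half_zero _ _
      _ ≤ 3 * Real.exp 3 / 81 := div_le_div_of_nonneg_left (by positivity) (by norm_num) hcast
      _ = locCell 81 0 0 (1 / 2) := (locCell_half_zero _ _).symm
      _ ≤ 3 / 4 := h1

/-- **THE QUARTER-SOURCE-WITH-THE-NUMBER THRESHOLD IS EXACTLY 121** [decided numeral]: as above with the margin floor `½ ≤ s̄⁰`. -/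
theorem quarterSource_half_inhabited_iff {L : ℕ} (hL : 0 < L) :
    (∃ C cbar m N₀ A₀ sbar ρ' : ℝ, 0 ≤ C ∧ 0 ≤ cbar ∧ 0 ≤ m ∧ 0 ≤ N₀ ∧ 0 ≤ A₀ ∧ 1 / 4 ≤ m * N₀ * A₀ ∧ 1 / 2 ≤ sbar ∧
      locCell (L : ℝ) C cbar (1 / 2) ≤ ρ' ∧ ρ' < 1 ∧ m * (N₀ * A₀ * (1 - ρ')⁻¹) ≤ 1 - sbar) ↔ 121 ≤ L := by
  constructor
  · rintro ⟨C, cbar, m, N₀, A₀, sbar, ρ', hC, hcbar, hm, hN₀, hA₀, hq, hs, hloc, hρ'1, hsmall⟩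
    exact oneTwentyOne_le_of_quarterSource_half hL hC hcbar hm hN₀ hA₀ hloc hρ'1 hsmall hq hs
  · intro h121
    have hcast : (121 : ℝ) ≤ (L : ℝ) := by exact_mod_cast h121
    obtain ⟨h1, h2, h3⟩ := cell_window_oneTwentyOne (0 : ℝ)
    refine ⟨0, 0, 1 / 4, 1, 1, 1 / 2, 1 / 2, le_rfl, le_rfl, by norm_num, zero_le_one, zero_le_one, by norm_num, le_rfl, ?_,
      h2, h3⟩
    calc locCell (L : ℝ) 0 0 (1 / 2) = 3 * Real.exp 3 / L := locCell_half_zero _ _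
      _ ≤ 3 * Real.exp 3 / 121 := div_le_div_of_nonneg_left (by positivity) (by norm_num) hcast
      _ = locCell 121 0 0 (1 / 2) := (locCell_half_zero _ _).symm
      _ ≤ 1 / 2 := h1

/-! ## §4 The same read on END-B's one `U` built by the cell -/

/-- **ON THE CELL's `UniformConstants`** [bookkeeping]: for `U := uniformConstantsCell L C c̄ κ N₀ A₀ m s̄⁰ ρ′ …` (row S3), the
coupled threshold holds with `U`'s own fields: `alphaCell κ·(1 − U.sbar) + L·(U.m·U.N₀·U.A₀) ≤ L·(1 − U.sbar)`. -/
theorem coupled_of_uniformConstantsCell {L C cbar κ N₀ A₀ m sbar ρ' : ℝ} (hL : 1 ≤ L) (hC : 0 ≤ C) (hcbar : 0 ≤ cbar)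
    (hκ : 0 ≤ κ) (hN₀ : 0 ≤ N₀) (hA₀ : 0 ≤ A₀) (hm : 0 ≤ m) (hloc : locCell L C cbar κ ≤ ρ') (hρ'1 : ρ' < 1)
    (hsmall : m * (N₀ * A₀ * (1 - ρ')⁻¹) ≤ 1 - sbar) :
    alphaCell κ * (1 - (uniformConstantsCell L C cbar κ N₀ A₀ m sbar ρ' hL hC hcbar hκ hN₀ hA₀ hm hloc hρ'1 hsmall).sbar) +
        L * ((uniformConstantsCell L C cbar κ N₀ A₀ m sbar ρ' hL hC hcbar hκ hN₀ hA₀ hm hloc hρ'1 hsmall).m *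
          (uniformConstantsCell L C cbar κ N₀ A₀ m sbar ρ' hL hC hcbar hκ hN₀ hA₀ hm hloc hρ'1 hsmall).N₀ *
          (uniformConstantsCell L C cbar κ N₀ A₀ m sbar ρ' hL hC hcbar hκ hN₀ hA₀ hm hloc hρ'1 hsmall).A₀) ≤
      L * (1 - (uniformConstantsCell L C cbar κ N₀ A₀ m sbar ρ' hL hC hcbar hκ hN₀ hA₀ hm hloc hρ'1 hsmall).sbar) :=
  coupled_of_cell_window (by linarith) hC hcbar hm hN₀ hA₀ hloc hρ'1 hsmall

/-! ## §5 The other half of LF-4: the (I4′) rate binder forces RATE DOMINATION of any geometric defect family -/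

/-- **A GEOMETRIC DEFECT FAMILY UNDER THE (I4′) RATE BINDER RUNS AT MOST AT THE CELL RATE** [arith]: if defects `c·φ^k` with a
positive amplitude `c` meet `c·φ^k ≤ c_δ·ψ^k` at EVERY scale `k` (the shape of the terminal face's `hrate` at `k′ = 0`, all cutoffs),
then `φ ≤ ψ` — no constant `c_δ` buys a faster internal rate.  (Archimedean: `(φ∕ψ)^k` is unbounded for `φ∕ψ > 1`.) -/
theorem rate_le_of_pow_dominated {c cδ φ ψ : ℝ} (hc : 0 < c) (hψ : 0 < ψ) (h : ∀ k : ℕ, c * φ ^ k ≤ cδ * ψ ^ k) :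
    φ ≤ ψ := by
  by_contra hlt
  have hφψ : 1 < φ / ψ := (one_lt_div hψ).mpr (not_le.mp hlt)
  obtain ⟨n, hn⟩ := pow_unbounded_of_one_lt (cδ / c) hφψ
  have hk := h n
  have hψn : 0 < ψ ^ n := pow_pos hψ n
  have h1 : (φ / ψ) ^ n ≤ cδ / c := by
    rw [div_pow, div_le_div_iff₀ hψn hc]
    linarith
  exact absurd hn (not_lt.mpr h1)

/-- **… IN BLOCK-SIZE CURRENCY** [arith]: a toy whose transverse defects decay like `(Lt²)⁻¹` per scale (internal block size `Lt > 0`)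
meets the terminal face's `hrate` at the cell rate `ψ = (L²)⁻¹` at every scale only if `L ≤ Lt` — the cell's integer blocking factor is
CAPPED by the toy's internal one (for the crew's `towerM`, `Lt = LW = 6e³`: `L ≤ 120`). -/
theorem blockSize_le_of_pow_dominated {c cδ L Lt : ℝ} (hc : 0 < c) (hL : 0 < L) (hLt : 0 < Lt)
    (h : ∀ k : ℕ, c * ((Lt ^ 2)⁻¹) ^ k ≤ cδ * ((L ^ 2)⁻¹) ^ k) : L ≤ Lt := by
  have hr := rate_le_of_pow_dominated hc (by positivity) h
  have h2 : L ^ 2 ≤ Lt ^ 2 := by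
    rwa [inv_le_inv₀ (by positivity) (by positivity)] at hr
  nlinarith

end Summit.QuantumFields.BalabanUV.T4Continuum.NE1p.DressedCellNecessityBudget

end
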